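import Mathlib

/-!
# Crux `UniformPhotonSphereChannelsR` (K1R, stmt-FinalStateConjecture-14074), line
# `crum-peeling-recessive-tower` — stub (F): the coefficient arrays of the dimensionless ladder

The registered stub `stub_coeffExists` of the line's skeleton v4 (continuation lead c2).  Writing the
recessive Riccati variables of the peeled Regge–Wheeler ladder as `W_k = −((ℓ−k)/r)·ω_k(M/r)` with
power series `ω_k(w) = Σ_n Ω k n wⁿ`, the chain becomes an explicit triangular rational recursion
for the coefficients:

* rung `0`: `ℓ² ω₀² + ℓ f (w ω₀)′ = f (L + β w)` (`f = 1 − 2w`, `L = ℓ(ℓ+1)`, `β = 2(1 − s²)`);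
* rung map (`λ = ℓ − k ≥ 2`): `(λ−1)² ν² + (λ−1) f (w ν)′ = λ² ω² − λ f (w ω)′`;
* `g_k = 1/ω_k`, with coefficients `G k n`, is the formal series inverse of `ω_k`.

This file only CONSTRUCTS some arrays `Ω G : ℕ → ℕ → ℝ` obeying the five registered clauses
(normalisations `Ω k 0 = G k 0 = 1`, the inversion identity, the rung-`0` recursion, the rung maps
for `k + 2 ≤ ℓ`).  At order `n ≥ 1` the unknown coefficient enters each rung equation linearly,
with the non-vanishing pivot `c (2c + n + 1)` (`c = ℓ ≥ 1`, resp. `c = ℓ − k − 1 ≥ 1`), because the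
convolution `Σ_{i ≤ n} ω i ω (n − i)` contains `ω n` exactly twice; so each rung is solved by
strong recursion on `n` (`coeffExists_rung`), the rungs are stacked by recursion on `k`
(`coeffExists_tower`; past the last rung the normalised trivial series is used), and the inverse
series is the usual triangular solve (`coeffExists_invSeries`).
-/

-- `Summit.<S>.<S>` repeats a namespace component by design (D-0017); off here as in the lakefile.
set_option linter.dupNamespace false

namespace Summit.FinalStateConjecture.FinalStateConjecture.Theorems.CrumPeelingRecessiveTower

/-- **One rung of the coefficient recursion.**  For a pivot constant `c > 0` and any right-hand
side `rhs` compatible with the normalisation at order `0` (`rhs 0 = c² + c`), the triangular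
recursion `c² Σ_{i ≤ n} ω i ω (n−i) + c ((n+1) ω n − 2n ω (n−1)) = rhs n` has a solution with
`ω 0 = 1`: at order `n ≥ 1` the coefficient `ω n` enters with the pivot `2c² + c(n+1) > 0`. -/
theorem coeffExists_rung (c : ℝ) (hc : 0 < c) (rhs : ℕ → ℝ) (h0 : rhs 0 = c ^ 2 + c) :
    ∃ ω : ℕ → ℝ, ω 0 = 1 ∧ ∀ n : ℕ,
      c ^ 2 * ∑ i ∈ Finset.range (n + 1), ω i * ω (n - i)
        + c * (((n : ℝ) + 1) * ω n - 2 * (n : ℝ) * ω (n - 1)) = rhs n := by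
  -- the solution of the triangular recursion, by strong recursion on the order
  obtain ⟨ω, hω⟩ : ∃ ω : ℕ → ℝ, ∀ n, ω n = if n = 0 then 1 else
      (rhs n - c ^ 2 * ∑ i ∈ Finset.range (n - 1), ω (i + 1) * ω (n - 1 - i)
        + 2 * c * (n : ℝ) * ω (n - 1)) / (2 * c ^ 2 + c * ((n : ℝ) + 1)) := by
    refine ⟨fun n => Nat.strongRec (motive := fun _ => ℝ) (fun n ih => if hn : n = 0 then (1 : ℝ)
      else (rhs n - c ^ 2 * ∑ i : Fin (n - 1),
              ih (i.1 + 1) (by have := i.2; omega) * ih (n - 1 - i.1) (by have := i.2; omega)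
            + 2 * c * (n : ℝ) * ih (n - 1) (by omega)) / (2 * c ^ 2 + c * ((n : ℝ) + 1))) n,
      fun n => ?_⟩
    dsimp only
    rw [Nat.strongRec_eq]
    by_cases hn : n = 0
    · simp [hn]
    · simp only [hn, dif_neg, if_false, not_false_eq_true, Finset.sum_range]
  have hω0 : ω 0 = 1 := by rw [hω]; simp
  refine ⟨ω, hω0, fun n => ?_⟩
  cases n with
  | zero => simp [hω0, h0]
  | succ m =>
    have hpiv : (2 * c ^ 2 + c * ((m : ℝ) + 1 + 1)) ≠ 0 := by positivity
    -- the defining relation at order `m + 1`, denominators cleared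
    have hωm : ω (m + 1) * (2 * c ^ 2 + c * ((m : ℝ) + 1 + 1))
        = rhs (m + 1) - c ^ 2 * ∑ i ∈ Finset.range m, ω (i + 1) * ω (m - i)
          + 2 * c * ((m : ℝ) + 1) * ω m := by
      rw [← eq_div_iff hpiv, hω (m + 1), if_neg (Nat.succ_ne_zero m)]
      simp only [Nat.add_sub_cancel, Nat.cast_add, Nat.cast_one]
    -- peel the two occurrences `i = 0`, `i = m + 1` of `ω (m + 1)` off the convolution
    rw [Finset.sum_range_succ, Finset.sum_range_succ']
    simp only [Nat.sub_self, Nat.sub_zero, Nat.add_sub_add_right, Nat.add_sub_cancel, hω0,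
      Nat.cast_add, Nat.cast_one]
    linear_combination hωm

/-- **Formal series inverse.**  A normalised coefficient sequence `ω` (`ω 0 = 1`) has a normalised
convolution inverse `g`: `Σ_{i ≤ n} g i ω (n − i) = [n = 0]`. -/
theorem coeffExists_invSeries (ω : ℕ → ℝ) (hω0 : ω 0 = 1) :
    ∃ g : ℕ → ℝ, g 0 = 1 ∧
      ∀ n, ∑ i ∈ Finset.range (n + 1), g i * ω (n - i) = if n = 0 then 1 else 0 := by
  obtain ⟨g, hg⟩ : ∃ g : ℕ → ℝ, ∀ n,
      g n = if n = 0 then 1 else -∑ i ∈ Finset.range n, g i * ω (n - i) := by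
    refine ⟨fun n => Nat.strongRec (motive := fun _ => ℝ)
      (fun n ih => if n = 0 then (1 : ℝ) else -∑ i : Fin n, ih i.1 i.2 * ω (n - i.1)) n,
      fun n => ?_⟩
    dsimp only
    rw [Nat.strongRec_eq]
    simp only [Finset.sum_range]
  have hg0 : g 0 = 1 := by rw [hg]; simp
  refine ⟨g, hg0, fun n => ?_⟩
  rw [Finset.sum_range_succ, Nat.sub_self, hω0, mul_one]
  rcases Nat.eq_zero_or_pos n with rfl | hn
  · simp [hg0]
  · rw [hg n, if_neg hn.ne', if_neg hn.ne']
    ring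

/-- **Stacking the rungs.**  Plain recursion on the rung index: from a bottom sequence `ω₀` and a
rung map `next k : (ℕ → ℝ) → (ℕ → ℝ)` one gets a tower `Ω` with `Ω 0 = ω₀` and
`Ω (k+1) = next k (Ω k)`. -/
theorem coeffExists_tower (ω₀ : ℕ → ℝ) (next : ℕ → (ℕ → ℝ) → ℕ → ℝ) :
    ∃ Ω : ℕ → ℕ → ℝ, Ω 0 = ω₀ ∧ ∀ k, Ω (k + 1) = next k (Ω k) :=
  ⟨fun k => Nat.rec (motive := fun _ => ℕ → ℝ) ω₀ (fun k ih => next k ih) k, rfl, fun _ => rfl⟩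

/-- **Stub (F): the coefficient arrays exist.**  For `1 ≤ ℓ` there are arrays
`Ω G : ℕ → ℕ → ℝ` with `Ω k 0 = G k 0 = 1`, with `G k` the convolution inverse of `Ω k` for every
`k`, with `Ω 0` solving the rung-`0` recursion
`ℓ² Σ_{i≤n} Ω 0 i Ω 0 (n−i) + ℓ ((n+1) Ω 0 n − 2n Ω 0 (n−1)) = [coefficients of f (L + β w)]`
(`L = ℓ(ℓ+1)`, `β = 2(1 − s²)`, `f = 1 − 2w`), and with consecutive rungs `Ω k`, `Ω (k+1)` related
by the rung map for every `k + 2 ≤ ℓ`. -/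
theorem stub_coeffExists :
    ∀ (s ℓ : ℕ), 1 ≤ ℓ → ∃ (Ω G : ℕ → ℕ → ℝ),
      (∀ k, Ω k 0 = 1) ∧ (∀ k, G k 0 = 1) ∧
      (∀ k n, ∑ i ∈ Finset.range (n + 1), G k i * Ω k (n - i) = if n = 0 then 1 else 0) ∧
      (∀ n, (ℓ : ℝ) ^ 2 * ∑ i ∈ Finset.range (n + 1), Ω 0 i * Ω 0 (n - i)
          + (ℓ : ℝ) * (((n : ℝ) + 1) * Ω 0 n - 2 * (n : ℝ) * Ω 0 (n - 1))
          = (if n = 0 then (ℓ : ℝ) * ((ℓ : ℝ) + 1)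
             else if n = 1 then 2 * (1 - (s : ℝ) ^ 2) - 2 * ((ℓ : ℝ) * ((ℓ : ℝ) + 1))
             else if n = 2 then -(4 * (1 - (s : ℝ) ^ 2)) else 0)) ∧
      (∀ k, k + 2 ≤ ℓ → ∀ n,
          ((ℓ : ℝ) - k - 1) ^ 2 * ∑ i ∈ Finset.range (n + 1), Ω (k + 1) i * Ω (k + 1) (n - i)
          + ((ℓ : ℝ) - k - 1) * (((n : ℝ) + 1) * Ω (k + 1) n - 2 * (n : ℝ) * Ω (k + 1) (n - 1))
          = ((ℓ : ℝ) - k) ^ 2 * ∑ i ∈ Finset.range (n + 1), Ω k i * Ω k (n - i)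
          - ((ℓ : ℝ) - k) * (((n : ℝ) + 1) * Ω k n - 2 * (n : ℝ) * Ω k (n - 1))) := by
  intro s ℓ hℓ
  have hℓ' : (0 : ℝ) < ℓ := by exact_mod_cast hℓ
  -- rung `0`
  obtain ⟨ω₀, hω₀0, hω₀⟩ := coeffExists_rung (ℓ : ℝ) hℓ'
    (fun n => if n = 0 then (ℓ : ℝ) * ((ℓ : ℝ) + 1)
      else if n = 1 then 2 * (1 - (s : ℝ) ^ 2) - 2 * ((ℓ : ℝ) * ((ℓ : ℝ) + 1))
      else if n = 2 then -(4 * (1 - (s : ℝ) ^ 2)) else 0)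
    (by rw [if_pos rfl]; ring)
  -- the rung maps `Ω k ↦ Ω (k+1)` (the normalised trivial series past the last rung)
  have hnext : ∀ (k : ℕ) (ω : ℕ → ℝ), ∃ ν : ℕ → ℝ, ν 0 = 1 ∧ (ω 0 = 1 → k + 2 ≤ ℓ → ∀ n,
      ((ℓ : ℝ) - k - 1) ^ 2 * ∑ i ∈ Finset.range (n + 1), ν i * ν (n - i)
        + ((ℓ : ℝ) - k - 1) * (((n : ℝ) + 1) * ν n - 2 * (n : ℝ) * ν (n - 1))
      = ((ℓ : ℝ) - k) ^ 2 * ∑ i ∈ Finset.range (n + 1), ω i * ω (n - i)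
        - ((ℓ : ℝ) - k) * (((n : ℝ) + 1) * ω n - 2 * (n : ℝ) * ω (n - 1))) := by
    intro k ω
    by_cases h : ω 0 = 1 ∧ k + 2 ≤ ℓ
    · obtain ⟨hω, hk⟩ := h
      have hc : (0 : ℝ) < (ℓ : ℝ) - k - 1 := by
        have : ((k + 2 : ℕ) : ℝ) ≤ ℓ := by exact_mod_cast hk
        push_cast at this
        linarith
      obtain ⟨ν, hν0, hν⟩ := coeffExists_rung ((ℓ : ℝ) - k - 1) hc
        (fun n => ((ℓ : ℝ) - k) ^ 2 * ∑ i ∈ Finset.range (n + 1), ω i * ω (n - i)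
          - ((ℓ : ℝ) - k) * (((n : ℝ) + 1) * ω n - 2 * (n : ℝ) * ω (n - 1)))
        (by simp only [zero_add, Finset.sum_range_one, Nat.sub_zero, hω, Nat.cast_zero]; ring)
      exact ⟨ν, hν0, fun _ _ => hν⟩
    · exact ⟨fun n => if n = 0 then 1 else 0, by simp, fun h1 h2 => absurd ⟨h1, h2⟩ h⟩
  choose next hnext0 hnexteq using hnext
  obtain ⟨Ω, hΩ0, hΩs⟩ := coeffExists_tower ω₀ next
  have hΩnorm : ∀ k, Ω k 0 = 1 := by
    intro k
    induction k with
    | zero => rw [hΩ0]; exact hω₀0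
    | succ k _ => rw [hΩs]; exact hnext0 _ _
  have hG := fun k => coeffExists_invSeries (Ω k) (hΩnorm k)
  choose G hG0 hGinv using hG
  refine ⟨Ω, G, hΩnorm, hG0, hGinv, ?_, ?_⟩
  · rw [hΩ0]
    exact hω₀
  · intro k hk n
    rw [hΩs k]
    exact hnexteq k (Ω k) (hΩnorm k) hk n

end Summit.FinalStateConjecture.FinalStateConjecture.Theorems.CrumPeelingRecessiveTower
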